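import Summits.QuantumFields.YangMills.Theorems.LangevinControlUVFemtoCurvatureSkewnessDefs
import Summits.QuantumFields.YangMills.Theorems.FemtoCurvatureSkewness.Negative.FalseOfUniformZeros

/-!
# Route `LangevinControlUV`, crux `FemtoCurvatureSkewness` (stmt-QuantumFields-9365): the reductions of line `coupling-cubic-response`

Companion of `LangevinControlUVFemtoCurvatureSkewnessDefs.lean` (route-posited vocabulary + the UV glue
`signedRigidity_of_dominance` over the LANDED stubs `PressureCGF` p97990 / `TreeRatioFloor` p104535).  This file lands, sorry-free,
the line's composition theorems — what the crux work file `Cruxes/FemtoCurvatureSkewness/Lines/coupling_cubic_response.lean`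
kernel-checks modulo its three OPEN stubs E `MarkedCouplingDominance` (UV engine, crux-sized), S `GlobalSkewSign` (infrared sign),
R `InfraredFloor` (infrared floor):

* `skewnessPackage_of_floor`: the a-free floor implies the crux's conclusion for EVERY unit map (pure logic, `Γ₃ := δ ∘ (cΓ)`);
* `skewnessPackage_of_signedRigidity`: signed rigidity on the femto boxes of a PACKAGE map gives its skewness package
  (`Γ₃ := (cΓ)^{3/2}`);
* `skewnessForPackageMap_of` (registered sub-goal): **the ∃-bundled (R1) form of the crux holds modulo the engine E ALONE**;
  `skewnessForPackageMap_of_dominance`: honesty of the engine's map is not even needed for R1 (only for stub R);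
* `FemtoCurvatureSkewness_of`: **the typed `∀ a` crux holds modulo E ∧ S ∧ R** (conditional result; the three hypotheses are the
  line's open stubs, route-posited `def`s of the Defs file — nothing is asserted);
* `not_globalSkewSign_of_uniformZeros`: S dies under exactly the hypothesis `UniformZeros` under which the landed
  `FemtoCurvatureSkewness_false_of_UniformZeros` kills the crux (so S is no overreach relative to the typed crux).

Refs: line card `Cruxes/FemtoCurvatureSkewness/Lines/coupling-cubic-response.md`; Memo-forall-a-exposure (R1);
`Negative/WildPackage.lean`, `Negative/FalseOfUniformZeros.lean`; `Cruxes/FemtoCurvatureSkewness/Disproof.lean` (v6).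
-/

set_option autoImplicit false

noncomputable section

namespace Summit.QuantumFields.YangMills.Cruxes.FemtoCurvatureSkewness.CouplingCubicResponse

open MeasureTheory Filter Topology
open Literature.MathematicalPhysics.QuantumFieldTheory
open Summit.QuantumFields.YangMills.Theorems.FemtoCurvatureSkewness.Negative
  (plaq wE wCov kappa3 TwoPointPackage SkewnessPackage level_mem_window UniformZeros femtoCurvatureSkewness_iff)

section Glue

variable {G : Type} [Group G] [TopologicalSpace G] [IsTopologicalGroup G] [CompactSpace G]
  [MeasurableSpace G] [BorelSpace G]

/-- **Floor ⇒ the crux's conclusion, for EVERY unit map** (pure logic): the package's lower clause `cΓ(n a β) ≤ n⁸Cov` feeds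
the floor with `ε := cΓ(s)`; `Γ₃(s) := δ(cΓ(s))`, `c₃ := 1`, `ℓ₁ := ℓ₀`, `β₁ := max β₀ β_u`. -/
theorem skewnessPackage_of_floor (r : LatticeRep G) {a : ℝ → ℝ} (ha : TwoPointPackage r a)
    (hF : SkewnessFloor r) : SkewnessPackage r a := by
  obtain ⟨Γ, β₀, ℓ₀, c, C, hℓ₀, hc, hapos, -, hΓ, hbox⟩ := ha
  obtain ⟨βu, hFl⟩ := hF
  choose! δ hδpos hδ using hFl
  refine ⟨fun s => δ (c * Γ s), max β₀ βu, ℓ₀, 1, hℓ₀, one_pos, ?_, ?_⟩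
  · intro s hs hsl
    exact hδpos _ (mul_pos hc (hΓ s hs hsl).1)
  · intro L _ β hβ hL n hn h8
    have hβ₀ : β₀ ≤ β := le_trans (le_max_left _ _) hβ
    have hβu : βu ≤ β := le_trans (le_max_right _ _) hβ
    obtain ⟨hs, hsl⟩ := level_mem_window hapos hL hn h8
    have hε : 0 < c * Γ ((n : ℝ) * a β) := mul_pos hc (hΓ _ hs hsl).1
    have hlow : c * Γ ((n : ℝ) * a β) ≤ (n : ℝ) ^ 8 * covAxis r L β n := ((hbox L β hβ₀ hL).1 n hn h8).1
    show 1 * δ (c * Γ ((n : ℝ) * a β)) ≤ (n : ℝ) ^ 12 * |kappa3 r L β n|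
    rw [one_mul]
    exact hδ _ hε L β n hβu hn h8 hlow

/-- **Signed rigidity on the femto boxes of a PACKAGE map ⇒ its skewness package** (elementary; the closing algebra of the
ratio cards): `c₃ (n⁸Cov)^{3/2} ≥ c₃ (cΓ(n a β))^{3/2}` by the package's own lower clause; `Γ₃ := (cΓ)^{3/2}`. -/
theorem skewnessPackage_of_signedRigidity (r : LatticeRep G) {a : ℝ → ℝ} (ha : TwoPointPackage r a)
    (hR : SignedRigidity r a) : SkewnessPackage r a := by
  obtain ⟨β₁, ℓ₁, c₃, hℓ₁, hc₃, hRb⟩ := hR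
  obtain ⟨Γ, β₀, ℓ₀, c, C, hℓ₀, hc, hapos, -, hΓ, hbox⟩ := ha
  refine ⟨fun s => (c * Γ s) * Real.sqrt (c * Γ s), max β₁ β₀, min ℓ₁ ℓ₀, c₃, lt_min hℓ₁ hℓ₀, hc₃, ?_, ?_⟩
  · intro s hs hsl
    have : 0 < c * Γ s := mul_pos hc (hΓ s hs (hsl.trans (min_le_right _ _))).1
    show 0 < c * Γ s * Real.sqrt (c * Γ s)
    exact mul_pos this (Real.sqrt_pos.2 this)
  · intro L _ β hβ hL n hn h8
    have hβ₁ : β₁ ≤ β := le_trans (le_max_left _ _) hβ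
    have hβ₀ : β₀ ≤ β := le_trans (le_max_right _ _) hβ
    have hL₁ : (L : ℝ) * a β ≤ ℓ₁ := hL.trans (min_le_left _ _)
    have hL₀ : (L : ℝ) * a β ≤ ℓ₀ := hL.trans (min_le_right _ _)
    obtain ⟨hCpos, hrig⟩ := hRb L β hβ₁ hL₁ n hn h8
    have hlow : c * Γ ((n : ℝ) * a β) ≤ (n : ℝ) ^ 8 * covAxis r L β n := ((hbox L β hβ₀ hL₀).1 n hn h8).1
    obtain ⟨hs, hsl⟩ := level_mem_window hapos hL₀ hn h8
    have hpos : 0 ≤ c * Γ ((n : ℝ) * a β) := (mul_pos hc (hΓ _ hs hsl).1).le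
    set A := (n : ℝ) ^ 8 * covAxis r L β n with hA
    have hmono : c * Γ ((n : ℝ) * a β) * Real.sqrt (c * Γ ((n : ℝ) * a β)) ≤ A * Real.sqrt A :=
      mul_le_mul hlow (Real.sqrt_le_sqrt hlow) (Real.sqrt_nonneg _) (hpos.trans hlow)
    have hn4 : (0 : ℝ) ≤ (n : ℝ) ^ 4 := by positivity
    have hAsqrt : Real.sqrt A = (n : ℝ) ^ 4 * Real.sqrt (covAxis r L β n) := by
      rw [hA, show ((n : ℝ) ^ 8) = ((n : ℝ) ^ 4) ^ 2 by ring, Real.sqrt_mul (sq_nonneg _), Real.sqrt_sq hn4]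
    have hkey : A * Real.sqrt A = (n : ℝ) ^ 12 * (covAxis r L β n * Real.sqrt (covAxis r L β n)) := by
      rw [hAsqrt, hA]; ring
    show c₃ * (c * Γ ((n : ℝ) * a β) * Real.sqrt (c * Γ ((n : ℝ) * a β))) ≤ (n : ℝ) ^ 12 * |kappa3 r L β n|
    calc c₃ * (c * Γ ((n : ℝ) * a β) * Real.sqrt (c * Γ ((n : ℝ) * a β)))
        ≤ c₃ * (A * Real.sqrt A) := mul_le_mul_of_nonneg_left hmono hc₃.le
      _ = (n : ℝ) ^ 12 * (c₃ * covAxis r L β n * Real.sqrt (covAxis r L β n)) := by rw [hkey]; ring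
      _ ≤ (n : ℝ) ^ 12 * kappa3 r L β n := mul_le_mul_of_nonneg_left hrig (by positivity)
      _ ≤ (n : ℝ) ^ 12 * |kappa3 r L β n| := mul_le_mul_of_nonneg_left (le_abs_self _) (by positivity)

end Glue

/-! ## The two compositions -/

/-- **R1 (kernel): the ENGINE ALONE gives the ∃-bundled form of the crux** — stubs I and T being theorems, `SkewnessForPackageMap`
holds modulo `MarkedCouplingDominance` only; the infrared stubs S and R are needed only for the typed `∀ a` shell.  Registered
sub-goal `skewnessForPackageMap_of`. -/
theorem skewnessForPackageMap_of : MarkedCouplingDominance → SkewnessForPackageMap := by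
  intro hE G _ _ _ _ hG
  letI : MeasurableSpace G := borel G
  haveI : BorelSpace G := ⟨rfl⟩
  intro r hex
  obtain ⟨a₀, -, hP₀, hD₀⟩ := hE G hG r hex
  exact ⟨a₀, hP₀, skewnessPackage_of_signedRigidity r hP₀ (signedRigidity_of_dominance r a₀ hD₀)⟩

/-- **The minimal engine for R1** (kernel): honesty of the engine's unit map is NOT used by the ∃-bundled form — any package map
carrying `PressureDominance` on its own femto boxes suffices (the `IsHonestUnitMap` clause of stub E only feeds stub R).  So the
item a planner promotes out of E may drop honesty if only the R1 form of the crux is wanted. -/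
theorem skewnessForPackageMap_of_dominance
    (hE' : ∀ (G : Type) [Group G] [TopologicalSpace G] [IsTopologicalGroup G] [CompactSpace G]
      [MeasurableSpace G] [BorelSpace G], IsCompactSimpleLieGroup G →
      ∀ (r : LatticeRep G), (∃ a : ℝ → ℝ, TwoPointPackage r a) →
        ∃ a : ℝ → ℝ, TwoPointPackage r a ∧ PressureDominance r a) :
    SkewnessForPackageMap := by
  intro G _ _ _ _ hG
  letI : MeasurableSpace G := borel G
  haveI : BorelSpace G := ⟨rfl⟩
  intro r hex
  obtain ⟨a₀, hP₀, hD₀⟩ := hE' G hG r hex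
  exact ⟨a₀, hP₀, skewnessPackage_of_signedRigidity r hP₀ (signedRigidity_of_dominance r a₀ hD₀)⟩

/-- **`FemtoCurvatureSkewness_of`** — the line's composition, now over exactly the THREE open stubs E, S, R (I and T are
theorems): the engine yields an honest package map `a⋆` with pressure dominance; the landed CGF identities and tree ratio floor
turn it into signed rigidity on `a⋆`-boxes (`signedRigidity_of_dominance`); the infrared floor (fed the global sign) makes
positivity uniform on `{n⁸Cov ≥ ε}`; the floor closes the package of the crux's ARBITRARY unit map `a` by pure logic.
CONDITIONAL on the three open stubs; nothing is asserted. -/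
theorem FemtoCurvatureSkewness_of :
    MarkedCouplingDominance → GlobalSkewSign → InfraredFloor →
      Summit.QuantumFields.YangMills.Theses.LangevinControlUV.FemtoCurvatureSkewness := by
  intro hE hS hR
  rw [femtoCurvatureSkewness_iff]
  intro G _ _ _ _ hG
  letI : MeasurableSpace G := borel G
  haveI : BorelSpace G := ⟨rfl⟩
  intro r a ha
  obtain ⟨a₀, hhon, hP₀, hD₀⟩ := hE G hG r ⟨a, ha⟩
  have hRig : SignedRigidity r a₀ := signedRigidity_of_dominance r a₀ hD₀
  exact skewnessPackage_of_floor r ha (hR G hG r a₀ hhon hP₀ hRig (hS G hG r))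

/-! ## Check against the landed negative lemmas -/

/-- **The sign stub dies under exactly the hypothesis that kills the crux** (`Negative/FalseOfUniformZeros.lean`): zeros of
`κ₃` along `β_k → ∞` (with or without the covariance uniformities) contradict `GlobalSkewSign`.  So stub S is not an overreach
relative to the typed crux's known vulnerability. -/
theorem not_globalSkewSign_of_uniformZeros (h : UniformZeros) : ¬ GlobalSkewSign := by
  intro hS
  unfold UniformZeros at h
  obtain ⟨G, _, _, _, _, hG, r, βu, K, -, -, -, -, -, -, βz, Lz, nz, hβz, hzero⟩ := h
  letI : MeasurableSpace G := borel G
  haveI : BorelSpace G := ⟨rfl⟩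
  obtain ⟨βu', hpos⟩ := hS G hG r
  obtain ⟨k, hk⟩ := (hβz.eventually (eventually_ge_atTop βu')).exists
  obtain ⟨hLz, hn1, hn8, hz⟩ := hzero k
  have key := hpos (Lz k) (βz k) (nz k) hk hn1 hn8
  rw [hz] at key
  exact lt_irrefl _ key

end Summit.QuantumFields.YangMills.Cruxes.FemtoCurvatureSkewness.CouplingCubicResponse

end
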